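import Literature.NumberTheory.Automorphic.UnitaryGroupBorelProductWeightIntegralTwo
import Literature.NumberTheory.Automorphic.UnitaryGroupIwasawaWeightExchange
import Literature.NumberTheory.Automorphic.UnitaryGroupIwasawaAdelic
import Literature.NumberTheory.Automorphic.UnitaryGroupTorusWindowIntegral
import Literature.NumberTheory.Automorphic.UnitaryGroupTorusRayTwo
import Literature.NumberTheory.Automorphic.UnitaryGroupCuspIntegralSiegelMajorant
import HarnessLib

/-!
# The window parts of Arthur's `J^{T'}(f) − J^{T}(f)` on `U(J₂)` integrate to `D · (∫_{K_U} θ) · (log T' − log T)`: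
# Iwasawa coordinates, weight exchange, `δ_B dμ_B = dμ_N dμ_T` and the one-ray torus window, composed
(Arthur, *The trace formula in invariant form*, Ann. of Math. 114 (1981), §2: `J^T(f)` is a polynomial in `T`;
Rogawski, *Automorphic Representations of Unitary Groups in Three Variables* (1990), §2.1 p. 12 — stated there for
`G = U(3)`, `U(2)` and `U(2) × U(1)` alike)

Topic `NumberTheory/Automorphic`; namespace `Literature.NumberTheory.Automorphic.UnitaryGroup`. THEOREMS ONLY
over accepted tree modules: no definition, no named fact, no instance, no notation, no `sorry`. The `N = 2` sibling
(H-side LAW 2 letter `TruncatedTraceWindowPartsTwo` of `CENSUS-LAWS-Hside` §3, for `H = U(Φ₂) × U(Φ₁)`) of ★ (L2-e1)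
`UnitaryGroupTruncatedTraceWindowParts`. After ★ (N2b) `exists_truncatedTraceClass_sub_eq_parts_two` (the exact
unfolding of `J^{T'}_𝔬(f) − J^{T}_𝔬(f)` on `U(J₂)`), each class difference is a combination of integrals
`∫⁻_{G(𝔸)} β(y) · 1_{T < H(y) ≤ T'} θ(y) dν_G` with `β` a covering weight of `B(F)♯` and `θ ≥ 0` measurable and
`δ_B`-HOMOGENEOUS (`θ(b k) = δ_B(b) θ(k)`, `b ∈ B(𝔸)`, `k ∈ K_U`; ★ `kernelBorelClass_borel_mul_mul_two`). THIS FILE: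
for every such `θ`,
  `∫⁻ β · 1_{T<H≤T'} θ dν_G = D · (∫⁻_{K_U} θ dμ_K) · (log T' − log T)`   (`0 < T ≤ T'`),
with ONE constant `D` (independent of `θ, T, T'`), by composing ★ `exists_lintegral_weight_iwasawa_eq` (every `N`:
Iwasawa `G = B K_U` + exchange of `β(· k)` for the product covering weight `1_Ω(n_b) w_T(t_b)` of ★
`exists_isCoveringWeight_borel_indicator_mul`), ★ (W1) `exists_lintegral_productWeight_mul_torusRootModulus_mul_eq_two`
(order `b = n t` on `B(𝔸_F) ≤ U(J₂)(𝔸_F)`: `δ_B dμ_B = dμ_N dμ_T`, one positive root, ★ `UnitaryGroupBorelModulusTwo`)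
and ★ `exists_lintegral_weight_mul_indicator_window_eq` (every `N`: ray invariance on the torus ⇒ `C_T (log T' − log T)`),
the torus Siegel set of `U(J₂)` being ★ B-p14's ONE-RAY data `exists_torusSiegelData_two` (`S ⊆ ρ(ℝ) · 𝔎`,
`H(ρ(s) t) = e^{[E:ℚ]s} H(t)`, `T(𝔸) = T(F) · S` — `T(F)∖T(𝔸_F) = E^×∖𝕀_E` has ONE non-compact direction).

* §1 **`exists_lintegral_weight_windowPart_eq_of_siegelData_two`** — the window parts for GIVEN Haar measures
  `μ_B, μ_T, μ_N`, Iwasawa hypothesis `hBK` and torus Siegel data `(S, 𝔎, ρ)` (the binders of ★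
  `exists_lintegral_weight_mul_indicator_window_eq`), mirror of the `U(J₃)` head ★ `exists_lintegral_weight_windowPart_eq`.
* §2 **`exists_lintegral_weight_windowPart_eq_two (h2) (hc) (hc1) (hfix)`** — THE `N = 2` LAW 2 ENGINE with the
  Iwasawa decomposition (★ `exists_mem_borelAdelic_mul_mem_standardMaximalCompactGL`, every `N`), the Haar measures
  of `B(𝔸), T(𝔸), N(𝔸)` and the torus Siegel data (★ `exists_torusSiegelData_two`) DISCHARGED inside: exactly the
  binder `hwin` of ★ (N3a) `truncatedTraceClassPolynomial_of_parts_two` (`UnitaryGroupTruncatedTraceClassPolynomialOfRowsTwo`),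
  token for token; `exists_lintegral_weight_windowPart_eq_cm_two` — the CM pair `L/L⁺` (hypothesis-free).

## References

* J. Arthur, *The trace formula in invariant form*, Ann. of Math. 114 (1981), §2 [Arthur1981TraceFormulaInvariantForm].
* J. D. Rogawski, *Automorphic Representations of Unitary Groups in Three Variables*, Annals of Mathematics
  Studies 123 (1990), §2.1 (p. 12), §2.2 (p. 13) [Rogawski1990].
* J. R. Getz, H. Hahn, *An Introduction to Automorphic Representations*, GTM 300 (2024), Prop. 3.2.1, Thm. 2.7.1
  [GetzHahn2024].
-/

set_option autoImplicit false

noncomputable section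

open MeasureTheory Measure NumberField IsDedekindDomain Set Literature.MeasureTheory.Group
open scoped NNReal ENNReal Pointwise

namespace Literature.NumberTheory.Automorphic

namespace UnitaryGroup

variable {F E : Type} [Field F] [NumberField F] [Field E] [NumberField E] [Algebra F E]
  {c : E ≃ₐ[F] E}

/-! ## §1 The window parts on `U(J₂)` for given Haar measures, Iwasawa hypothesis and torus Siegel data -/

section SiegelData

variable [MeasurableSpace (quasiSplit F E c 2).Adelic] [BorelSpace (quasiSplit F E c 2).Adelic]

/-- **THE WINDOW PARTS OF `J^{T'} − J^{T}` ON `U(J₂)`, DATA-EXPLICIT FORM.**  Let `ν_G, μ_B, μ_K, μ_T, μ_N` be Haar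
measures of `U(J₂)(𝔸_F)`, `B(𝔸_F)`, `K_U`, `T(𝔸_F)`, `N(𝔸_F)`, assume the Iwasawa decomposition `G(𝔸) = B(𝔸) K_U`
(`hBK`), let `S ⊆ T(𝔸_F)` be a measurable torus Siegel set with `S ⊆ ρ(ℝ) · 𝔎` (`𝔎` compact, `ρ` a continuous family
along which `H(ρ(s) t) = e^{κ s} H(t)`, `κ > 0`) meeting every `T(F)`-orbit — the binders of ★
`exists_lintegral_weight_mul_indicator_window_eq`, supplied at `N = 2` by ★ `exists_torusSiegelData_two` — and `β` a
covering weight of `B(F)♯` on `G(𝔸_F)`. There is ONE constant `D ∈ [0, ∞]` such that for every measurable `θ ≥ 0` on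
`G(𝔸_F)` which is `δ_B`-homogeneous (`θ(b k) = δ_B(b) θ(k)`, `b ∈ B(𝔸)`, `k ∈ K_U`) and all `0 < T ≤ T'`:
`∫⁻ β(y) · 1_{T < H(y) ≤ T'} θ(y) dν_G = D · (∫⁻_{K_U} θ dμ_K) · (log T' − log T)`. The `N = 2` sibling of ★
`exists_lintegral_weight_windowPart_eq`. [cite: Arthur1981TraceFormulaInvariantForm, §2] [cite: Rogawski1990, §2.1 (p. 12)] -/
theorem exists_lintegral_weight_windowPart_eq_of_siegelData_two (hc : c * c = 1) (hc1 : c ≠ 1)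
    (νG : Measure (quasiSplit F E c 2).Adelic) [νG.IsHaarMeasure]
    (μB : Measure (borelAdelic F E c 2)) [μB.IsHaarMeasure]
    (μK : Measure ((standardMaximalCompactGL 2 E).comap
      (adelicVal F E c 2 ((StdForm.antidiagonal 2).over E)) : Subgroup (quasiSplit F E c 2).Adelic))
    [μK.IsHaarMeasure]
    (μT : Measure (torusInBorel F E c 2)) [μT.IsHaarMeasure]
    (μN : Measure (unipotentInBorel F E c 2)) [μN.IsHaarMeasure]
    (hBK : ∀ g : (quasiSplit F E c 2).Adelic, ∃ b ∈ borelAdelic F E c 2, ∃ k : (quasiSplit F E c 2).Adelic,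
      adelicVal F E c 2 ((StdForm.antidiagonal 2).over E) k ∈ standardMaximalCompactGL 2 E ∧ g = b * k)
    {S 𝔎 : Set (torusInBorel F E c 2)} (hSm : MeasurableSet S) (h𝔎 : IsCompact 𝔎)
    {ρ : ℝ → torusInBorel F E c 2} (hρc : Continuous ρ) {κ : ℝ} (hκ : 0 < κ)
    (hH : ∀ (s : ℝ) (t : torusInBorel F E c 2),
      (borelHeight (((ρ s * t : torusInBorel F E c 2) : borelAdelic F E c 2) : (quasiSplit F E c 2).Adelic) : ℝ) =
        Real.exp (κ * s) * borelHeight (((t : torusInBorel F E c 2) : borelAdelic F E c 2) : (quasiSplit F E c 2).Adelic))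
    (hsub : S ⊆ Set.range ρ * 𝔎)
    (hcov : ∀ t : torusInBorel F E c 2,
      ∃ τ : (rationalBorel F E c 2).subgroupOf (torusInBorel F E c 2), τ • t ∈ S)
    {β : (quasiSplit F E c 2).Adelic → ℝ≥0∞}
    (hβ : IsCoveringWeight ((arithmeticBorel F E c 2).map (quasiSplit F E c 2).arithmeticSubgroup.subtype) β) :
    ∃ D : ℝ≥0∞, ∀ θ : (quasiSplit F E c 2).Adelic → ℝ≥0∞, Measurable θ →
      (∀ (b : borelAdelic F E c 2) (k : (quasiSplit F E c 2).Adelic),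
        adelicVal F E c 2 ((StdForm.antidiagonal 2).over E) k ∈ standardMaximalCompactGL 2 E →
        θ ((b : (quasiSplit F E c 2).Adelic) * k) = ((torusRootModulus E 2 (diagUnit b.2) : ℝ≥0) : ℝ≥0∞) * θ k) →
      ∀ T T' : ℝ≥0, 0 < T → T ≤ T' →
        ∫⁻ y, β y * {y : (quasiSplit F E c 2).Adelic | T < borelHeight y ∧ borelHeight y ≤ T'}.indicator θ y ∂νG =
          D * (∫⁻ k, θ (k : (quasiSplit F E c 2).Adelic) ∂μK) *
            ENNReal.ofReal (Real.log (T' : ℝ) - Real.log (T : ℝ)) := by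
  -- the product weight `w = 1_Ω(b t_b⁻¹) · w_T(t_b)` of `B(F)` on `B(𝔸)`
  obtain ⟨Ω, wT, hΩm, hΩu, hwT, hw⟩ :=
    exists_isCoveringWeight_borel_indicator_mul (F := F) (E := E) (c := c) (N := 2)
  -- the three constants: Iwasawa + exchange, `δ_B d_ℓb = dn dt`, ray invariance
  obtain ⟨Ci, -, -, hLi⟩ := exists_lintegral_weight_iwasawa_eq (F := F) (E := E) (c := c) (N := 2) νG μB μK hBK
  obtain ⟨Cp, -, -, -, hLp⟩ := exists_lintegral_productWeight_mul_torusRootModulus_mul_eq_two (F := F) (E := E)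
    hc hc1 μB μT μN
  obtain ⟨CT, -, hLT⟩ := exists_lintegral_weight_mul_indicator_window_eq (F := F) (E := E) (c := c) (N := 2) μT
    hwT h𝔎 hρc hκ hH hSm hsub hcov
  refine ⟨Ci * (Cp * μN Ω * CT), fun θ hθ hθhom T T' hT hTT' => ?_⟩
  -- the Borel factor `Φ(b) = 1_{T < H(b) ≤ T'} δ_B(b)` and the torus window `φ`
  set Φ : borelAdelic F E c 2 → ℝ≥0∞ := fun b =>
    {b : borelAdelic F E c 2 | T < borelHeight (b : (quasiSplit F E c 2).Adelic) ∧
      borelHeight (b : (quasiSplit F E c 2).Adelic) ≤ T'}.indicator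
      (fun b => ((torusRootModulus E 2 (diagUnit b.2) : ℝ≥0) : ℝ≥0∞)) b with hΦdef
  set φ : torusInBorel F E c 2 → ℝ≥0∞ := {t : torusInBorel F E c 2 |
    T < borelHeight (((t : torusInBorel F E c 2) : borelAdelic F E c 2) : (quasiSplit F E c 2).Adelic) ∧
    borelHeight (((t : torusInBorel F E c 2) : borelAdelic F E c 2) : (quasiSplit F E c 2).Adelic) ≤ T'}.indicator 1
    with hφdef
  have hHB : Measurable fun b : borelAdelic F E c 2 => borelHeight (b : (quasiSplit F E c 2).Adelic) :=
    measurable_borelHeight.comp measurable_subtype_coe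
  have hWB : MeasurableSet {b : borelAdelic F E c 2 | T < borelHeight (b : (quasiSplit F E c 2).Adelic) ∧
      borelHeight (b : (quasiSplit F E c 2).Adelic) ≤ T'} :=
    hHB (measurableSet_Ioc (a := T) (b := T'))
  have hΦm : Measurable Φ := (measurable_coe_torusRootModulus_diagUnit (F := F) (E := E) (c := c) (N := 2)).indicator hWB
  have hHT : Measurable fun t : torusInBorel F E c 2 =>
      borelHeight (((t : torusInBorel F E c 2) : borelAdelic F E c 2) : (quasiSplit F E c 2).Adelic) :=
    measurable_borelHeight.comp (measurable_subtype_coe.comp measurable_subtype_coe)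
  have hWT : MeasurableSet {t : torusInBorel F E c 2 |
      T < borelHeight (((t : torusInBorel F E c 2) : borelAdelic F E c 2) : (quasiSplit F E c 2).Adelic) ∧
      borelHeight (((t : torusInBorel F E c 2) : borelAdelic F E c 2) : (quasiSplit F E c 2).Adelic) ≤ T'} :=
    hHT (measurableSet_Ioc (a := T) (b := T'))
  have hφm : Measurable φ := measurable_one.indicator hWT
  -- `Φ` is left `B(F)`-invariant (product formula: `H(γ b) = H(b)`, `δ_B(γ b) = δ_B(b)`)
  have hΦB : ∀ b₀ : borelAdelic F E c 2,
      (b₀ : (quasiSplit F E c 2).Adelic) ∈ (quasiSplit F E c 2).arithmeticSubgroup →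
      ∀ b : borelAdelic F E c 2, Φ (b₀ * b) = Φ b := by
    intro b₀ hb₀ b
    obtain ⟨γ, hγ⟩ := hb₀
    have hγB : (quasiSplit F E c 2).toAdelic γ ∈ borelAdelic F E c 2 := by rw [hγ]; exact b₀.2
    have hH : borelHeight (((b₀ * b : borelAdelic F E c 2)) : (quasiSplit F E c 2).Adelic) =
        borelHeight (b : (quasiSplit F E c 2).Adelic) := by
      rw [Subgroup.coe_mul, ← hγ, borelHeight_rational_borel_mul γ hγB]
    have hδ := torusRootModulus_diagUnit_rational_mul (⟨b₀, ⟨γ, hγ⟩⟩ : rationalBorel F E c 2) b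
    by_cases hb : b ∈ {b : borelAdelic F E c 2 | T < borelHeight (b : (quasiSplit F E c 2).Adelic) ∧
        borelHeight (b : (quasiSplit F E c 2).Adelic) ≤ T'}
    · have hb' : b₀ * b ∈ {b : borelAdelic F E c 2 | T < borelHeight (b : (quasiSplit F E c 2).Adelic) ∧
          borelHeight (b : (quasiSplit F E c 2).Adelic) ≤ T'} := by
        rw [Set.mem_setOf_eq, hH]; exact hb
      rw [hΦdef]
      simp only []
      rw [Set.indicator_of_mem hb', Set.indicator_of_mem hb]
      exact congrArg (fun r : ℝ≥0 => (r : ℝ≥0∞)) hδ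
    · have hb' : b₀ * b ∉ {b : borelAdelic F E c 2 | T < borelHeight (b : (quasiSplit F E c 2).Adelic) ∧
          borelHeight (b : (quasiSplit F E c 2).Adelic) ≤ T'} := by
        rw [Set.mem_setOf_eq, hH]; exact hb
      rw [hΦdef]
      simp only []
      rw [Set.indicator_of_notMem hb', Set.indicator_of_notMem hb]
  -- the Iwasawa factorisation `Ψ(b k) = Φ(b) θ(k)` of the window part
  have hΨm : Measurable fun y : (quasiSplit F E c 2).Adelic =>
      {y : (quasiSplit F E c 2).Adelic | T < borelHeight y ∧ borelHeight y ≤ T'}.indicator θ y :=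
    hθ.indicator (measurable_borelHeight (measurableSet_Ioc (a := T) (b := T')))
  have hΨ : ∀ (b : borelAdelic F E c 2) (k : (quasiSplit F E c 2).Adelic),
      adelicVal F E c 2 ((StdForm.antidiagonal 2).over E) k ∈ standardMaximalCompactGL 2 E →
      {y : (quasiSplit F E c 2).Adelic | T < borelHeight y ∧ borelHeight y ≤ T'}.indicator θ
          ((b : (quasiSplit F E c 2).Adelic) * k) = Φ b * θ k := by
    intro b k hk
    have hHk : borelHeight ((b : (quasiSplit F E c 2).Adelic) * k) = borelHeight (b : (quasiSplit F E c 2).Adelic) :=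
      borelHeight_mul_of_mem_comap_standardMaximalCompactGL (Subgroup.mem_comap.2 hk) _
    by_cases hb : b ∈ {b : borelAdelic F E c 2 | T < borelHeight (b : (quasiSplit F E c 2).Adelic) ∧
        borelHeight (b : (quasiSplit F E c 2).Adelic) ≤ T'}
    · have hy : (b : (quasiSplit F E c 2).Adelic) * k ∈
          {y : (quasiSplit F E c 2).Adelic | T < borelHeight y ∧ borelHeight y ≤ T'} := by
        rw [Set.mem_setOf_eq, hHk]; exact hb
      rw [Set.indicator_of_mem hy, hΦdef]
      simp only []
      rw [Set.indicator_of_mem hb, hθhom b k hk]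
    · have hy : (b : (quasiSplit F E c 2).Adelic) * k ∉
          {y : (quasiSplit F E c 2).Adelic | T < borelHeight y ∧ borelHeight y ≤ T'} := by
        rw [Set.mem_setOf_eq, hHk]; exact hb
      rw [Set.indicator_of_notMem hy, hΦdef]
      simp only []
      rw [Set.indicator_of_notMem hb, zero_mul]
  -- Step 1: Iwasawa + weight exchange
  have h1 := hLi β hβ _ hw Φ hΦm hΦB θ _ hθ hΨm hΨ
  rw [h1]
  -- Step 2: `Φ(b) = δ_B(b) · φ(torusPart b)` and `δ_B dμ_B = dμ_N dμ_T`
  have hΦφ : ∀ b : borelAdelic F E c 2, Φ b =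
      ((torusRootModulus E 2 (diagUnit b.2) : ℝ≥0) : ℝ≥0∞) * φ ⟨torusPart b, torusPart_mem_torusAdelic b⟩ := by
    intro b
    have hHt : borelHeight ((((⟨torusPart b, torusPart_mem_torusAdelic b⟩ : torusInBorel F E c 2) :
        borelAdelic F E c 2)) : (quasiSplit F E c 2).Adelic) = borelHeight (b : (quasiSplit F E c 2).Adelic) :=
      borelHeight_torusPart b
    by_cases hb : b ∈ {b : borelAdelic F E c 2 | T < borelHeight (b : (quasiSplit F E c 2).Adelic) ∧
        borelHeight (b : (quasiSplit F E c 2).Adelic) ≤ T'}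
    · have ht : (⟨torusPart b, torusPart_mem_torusAdelic b⟩ : torusInBorel F E c 2) ∈ {t : torusInBorel F E c 2 |
          T < borelHeight (((t : torusInBorel F E c 2) : borelAdelic F E c 2) : (quasiSplit F E c 2).Adelic) ∧
          borelHeight (((t : torusInBorel F E c 2) : borelAdelic F E c 2) : (quasiSplit F E c 2).Adelic) ≤ T'} := by
        rw [Set.mem_setOf_eq, hHt]; exact hb
      rw [hΦdef, hφdef]
      simp only []
      rw [Set.indicator_of_mem hb, Set.indicator_of_mem ht, Pi.one_apply, mul_one]
    · have ht : (⟨torusPart b, torusPart_mem_torusAdelic b⟩ : torusInBorel F E c 2) ∉ {t : torusInBorel F E c 2 |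
          T < borelHeight (((t : torusInBorel F E c 2) : borelAdelic F E c 2) : (quasiSplit F E c 2).Adelic) ∧
          borelHeight (((t : torusInBorel F E c 2) : borelAdelic F E c 2) : (quasiSplit F E c 2).Adelic) ≤ T'} := by
        rw [Set.mem_setOf_eq, hHt]; exact hb
      rw [hΦdef, hφdef]
      simp only []
      rw [Set.indicator_of_notMem hb, Set.indicator_of_notMem ht, mul_zero]
  have h2 : ∫⁻ b, (Ω.indicator (1 : unipotentInBorel F E c 2 → ℝ≥0∞)
        ⟨b * (torusPart b)⁻¹, mul_torusPart_inv_mem_unipotentInBorel b⟩ *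
        wT ⟨torusPart b, torusPart_mem_torusAdelic b⟩) * Φ b ∂μB =
      Cp * μN Ω * ∫⁻ t, wT t * φ t ∂μT := by
    simp_rw [hΦφ]
    exact hLp Ω hΩm wT hwT.measurable φ hφm
  rw [h2]
  -- Step 3: the torus window `= C_T (log T' − log T)`
  have h3 : ∫⁻ t, wT t * φ t ∂μT = CT * ENNReal.ofReal (Real.log (T' : ℝ) - Real.log (T : ℝ)) := hLT T T' hT hTT'
  rw [h3]
  ring

end SiegelData

/-! ## §2 THE `N = 2` LAW 2 ENGINE: Iwasawa, Haar measures and the torus Siegel set discharged -/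

/-- **THE WINDOW PARTS OF `J^{T'} − J^{T}` ON `U(J₂)`** (the binder `hwin` of ★ (N3a)
`truncatedTraceClassPolynomial_of_parts_two`, token for token).  Let `E/F` be quadratic (`[E:F] = 2`) with non-trivial
automorphism `c`, `c² = 1`, fixing every archimedean place of `E` (a CM-type hypothesis: Iwasawa ★
`exists_mem_borelAdelic_mul_mem_standardMaximalCompactGL`). For every pair of Haar measures `ν_G` of `U(J₂)(𝔸_F)` and
`μ_K` of `K_U` and every covering weight `β` of `B(F)♯` on `G(𝔸_F)` there is ONE `D ∈ [0, ∞]` such that for every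
measurable `δ_B`-homogeneous `θ ≥ 0` (`θ(b k) = δ_B(b) θ(k)`) and all `0 < T ≤ T'`:
`∫⁻ β(y) · 1_{T < H(y) ≤ T'} θ(y) dν_G = D · (∫⁻_{K_U} θ dμ_K) · (log T' − log T)` — §1 with Haar measures of
`B(𝔸), T(𝔸), N(𝔸)` and ★ B-p14's one-ray torus Siegel data `exists_torusSiegelData_two`. (Arthur (1981) §2;
Rogawski (1990) §2.1 p. 12: «each term in (2.1.1) is a polynomial in `T`», for `U(2)` as for `U(3)`.)
[cite: Arthur1981TraceFormulaInvariantForm, §2] [cite: Rogawski1990, §2.1 (p. 12)] -/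
theorem exists_lintegral_weight_windowPart_eq_two (h2 : Module.finrank F E = 2) (hc : c * c = 1) (hc1 : c ≠ 1)
    (hfix : ∀ w : InfinitePlace E, c • w = w)
    [MeasurableSpace (quasiSplit F E c 2).Adelic] [BorelSpace (quasiSplit F E c 2).Adelic]
    (νG : Measure (quasiSplit F E c 2).Adelic) [νG.IsHaarMeasure]
    (μK : Measure ((standardMaximalCompactGL 2 E).comap
      (adelicVal F E c 2 ((StdForm.antidiagonal 2).over E)) : Subgroup (quasiSplit F E c 2).Adelic))
    [μK.IsHaarMeasure]
    (β : (quasiSplit F E c 2).Adelic → ℝ≥0∞)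
    (hβ : IsCoveringWeight ((arithmeticBorel F E c 2).map (quasiSplit F E c 2).arithmeticSubgroup.subtype) β) :
    ∃ D : ℝ≥0∞, ∀ θ : (quasiSplit F E c 2).Adelic → ℝ≥0∞, Measurable θ →
      (∀ (b : borelAdelic F E c 2) (k : (quasiSplit F E c 2).Adelic),
        adelicVal F E c 2 ((StdForm.antidiagonal 2).over E) k ∈ standardMaximalCompactGL 2 E →
        θ ((b : (quasiSplit F E c 2).Adelic) * k) = ((torusRootModulus E 2 (diagUnit b.2) : ℝ≥0) : ℝ≥0∞) * θ k) →
      ∀ T T' : ℝ≥0, 0 < T → T ≤ T' →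
        ∫⁻ y, β y * {y : (quasiSplit F E c 2).Adelic | T < borelHeight y ∧ borelHeight y ≤ T'}.indicator θ y ∂νG =
          D * (∫⁻ k, θ (k : (quasiSplit F E c 2).Adelic) ∂μK) *
            ENNReal.ofReal (Real.log (T' : ℝ) - Real.log (T : ℝ)) := by
  -- Haar measures on `B(𝔸)`, `T(𝔸)`, `N(𝔸)`
  haveI : BorelSpace (borelAdelic F E c 2) := Subtype.borelSpace _
  haveI : LocallyCompactSpace (borelAdelic F E c 2) := locallyCompactSpace_borelAdelic
  haveI : T2Space (borelAdelic F E c 2) := t2Space_borelAdelic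
  haveI : LocallyCompactSpace (torusInBorel F E c 2) :=
    (isTopSemidirect_borelAdelic (F := F) (E := E) (c := c) (N := 2)).isClosed_left.locallyCompactSpace
  haveI : LocallyCompactSpace (unipotentInBorel F E c 2) :=
    (isTopSemidirect_borelAdelic (F := F) (E := E) (c := c) (N := 2)).isClosed_right.locallyCompactSpace
  set μB : Measure (borelAdelic F E c 2) := Measure.haar with hμB
  set μT : Measure (torusInBorel F E c 2) := Measure.haar with hμT
  set μN : Measure (unipotentInBorel F E c 2) := Measure.haar with hμN
  -- Iwasawa `G(𝔸) = B(𝔸) K_U` (`[E:F] = 2`) and the one-ray torus Siegel data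
  haveI : Algebra.IsQuadraticExtension F E := { finrank_eq_two' := h2 }
  have hBK : ∀ g : (quasiSplit F E c 2).Adelic, ∃ b ∈ borelAdelic F E c 2, ∃ k : (quasiSplit F E c 2).Adelic,
      adelicVal F E c 2 ((StdForm.antidiagonal 2).over E) k ∈ standardMaximalCompactGL 2 E ∧ g = b * k :=
    exists_mem_borelAdelic_mul_mem_standardMaximalCompactGL c hc1 hfix
  obtain ⟨S, 𝔎, ρ, hSm, h𝔎, hρc, hκ, hH, hsub, hcov⟩ :=
    exists_torusSiegelData_two (F := F) (E := E) (c := c) h2 hc hc1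
  exact exists_lintegral_weight_windowPart_eq_of_siegelData_two hc hc1 νG μB μK μT μN hBK hSm h𝔎 hρc hκ hH hsub
    hcov hβ

/-- **The CM pair `L/L⁺`** (`F = L⁺` the maximal real subfield, `c` complex conjugation): the window parts of
`J^{T'} − J^{T}` on Rogawski's quasi-split `U(J₂)` integrate to `D · (∫⁻_{K_U} θ) · (log T' − log T)` —
HYPOTHESIS-FREE (`[L:L⁺] = 2`, `c² = 1` (Mathlib `IsCMField.isQuadraticExtension`, `IsCMField.orderOf_complexConj`),
`c ≠ 1`, `c` fixes the archimedean places ★ `complexConj_smul_infinitePlace`). [cite: Arthur1981TraceFormulaInvariantForm, §2] [cite: Rogawski1990, §2.1 (p. 12)] -/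
theorem exists_lintegral_weight_windowPart_eq_cm_two (L : Type) [Field L] [NumberField L] [IsCMField L]
    [MeasurableSpace (quasiSplit (↥(maximalRealSubfield L)) L (IsCMField.complexConj L) 2).Adelic]
    [BorelSpace (quasiSplit (↥(maximalRealSubfield L)) L (IsCMField.complexConj L) 2).Adelic]
    (νG : Measure (quasiSplit (↥(maximalRealSubfield L)) L (IsCMField.complexConj L) 2).Adelic) [νG.IsHaarMeasure]
    (μK : Measure ((standardMaximalCompactGL 2 L).comap
      (adelicVal (↥(maximalRealSubfield L)) L (IsCMField.complexConj L) 2 ((StdForm.antidiagonal 2).over L)) :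
        Subgroup (quasiSplit (↥(maximalRealSubfield L)) L (IsCMField.complexConj L) 2).Adelic))
    [μK.IsHaarMeasure]
    (β : (quasiSplit (↥(maximalRealSubfield L)) L (IsCMField.complexConj L) 2).Adelic → ℝ≥0∞)
    (hβ : IsCoveringWeight ((arithmeticBorel (↥(maximalRealSubfield L)) L (IsCMField.complexConj L) 2).map
      (quasiSplit (↥(maximalRealSubfield L)) L (IsCMField.complexConj L) 2).arithmeticSubgroup.subtype) β) :
    ∃ D : ℝ≥0∞, ∀ θ : (quasiSplit (↥(maximalRealSubfield L)) L (IsCMField.complexConj L) 2).Adelic → ℝ≥0∞,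
      Measurable θ →
      (∀ (b : borelAdelic (↥(maximalRealSubfield L)) L (IsCMField.complexConj L) 2)
          (k : (quasiSplit (↥(maximalRealSubfield L)) L (IsCMField.complexConj L) 2).Adelic),
        adelicVal (↥(maximalRealSubfield L)) L (IsCMField.complexConj L) 2 ((StdForm.antidiagonal 2).over L) k ∈
          standardMaximalCompactGL 2 L →
        θ ((b : (quasiSplit (↥(maximalRealSubfield L)) L (IsCMField.complexConj L) 2).Adelic) * k) =
          ((torusRootModulus L 2 (diagUnit b.2) : ℝ≥0) : ℝ≥0∞) * θ k) →
      ∀ T T' : ℝ≥0, 0 < T → T ≤ T' →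
        ∫⁻ y, β y * {y : (quasiSplit (↥(maximalRealSubfield L)) L (IsCMField.complexConj L) 2).Adelic |
            T < borelHeight y ∧ borelHeight y ≤ T'}.indicator θ y ∂νG =
          D * (∫⁻ k, θ (k : (quasiSplit (↥(maximalRealSubfield L)) L (IsCMField.complexConj L) 2).Adelic) ∂μK) *
            ENNReal.ofReal (Real.log (T' : ℝ) - Real.log (T : ℝ)) :=
  exists_lintegral_weight_windowPart_eq_two (IsCMField.isQuadraticExtension L).finrank_eq_two
    (by rw [← pow_two, ← IsCMField.orderOf_complexConj L, pow_orderOf_eq_one]) (IsCMField.complexConj_ne_one L)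
    (complexConj_smul_infinitePlace L) νG μK β hβ

end UnitaryGroup

end Literature.NumberTheory.Automorphic
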